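import Summits.AtomisticToContinuum.Crystallization.Theorems.LayeredLawsSelectHcp.Negative.FccLattice

/-!
# Negative knowledge for crux `LayeredLawsSelectHcp` (stmt-AtomisticToContinuum-9226), IV:
# the energy hypothesis is load-bearing — the fcc Palm law satisfies H1, H2, H4 and is not hcp

Part IV (`--supports stmt-AtomisticToContinuum-9226`). The Palm law of the fcc lattice,
`fccLaw a = δ_{count|fccD3 a}` (`9/10 ≤ a ≤ 1`), is a probability law, rooted and `a`-separated
(`rooted_fccLaw`, H1 for every `δ ≤ a`), point-stationary (`pointStationary_fccLaw`, H2), layered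
(`layered_fccLaw`, H4), its H3 reads `½∫V_LJ(‖y‖) d(count|fccD3 a) ≤ e*` (`meanRootEnergy_fccLaw`), and
its sample is NOT a rotated relaxed hcp crystal (`not_isRelaxedHcp_fcc`: equal counting measures have
equal carriers, `fccD3 a` is a subgroup, `HcpNotBravais_holds`). Hence
**`layeredLawsSelectHcp_false_without_energy`** — the crux with H3 deleted (stated inline) is false
(witness `a = δ = 1`): no argument from H1, H2, H4 alone (layer combinatorics, rigidity, unimodularity)
reaches hcp; the SELECTION lives entirely in the `~10⁻⁴|e*|` fcc/hcp/polytype energy comparison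
(items 0670/3063; `Δ_{fcc/hcp}(12,6) = −1.00994·10⁻⁴`, Schwerdtfeger–Burrows–Smits 2021). The
conditional kill "fcc a periodic minimiser at some `a ∈ [9/10,1]` ⇒ ¬crux" (one line from
`meanRootEnergy_fccLaw`) is kept in the crux workfile `Cruxes/LayeredLawsSelectHcp/Disproof.lean`,
since its hypothesis is believed false. All `[folklore]`.
-/

noncomputable section

namespace Summit.AtomisticToContinuum.Crystallization.Theorems.LayeredLawsSelectHcp.Negative.FccModel

open MeasureTheory Set
open Literature.MathematicalPhysics.StatisticalMechanics Literature.Geometry.DiscreteGeometry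
open Summit.AtomisticToContinuum.Crystallization.Theses.PalmUnimodularRigidity (LayeredLawsSelectHcp)
open Summit.AtomisticToContinuum.Crystallization.Theorems.ChargedEnergyGapNegative
  (eStar eStar_le bddBelow_energyPerParticle_lennardJones)

/-- Euclidean `3`-space. [folklore] -/
local notation "E3" => EuclideanSpace ℝ (Fin 3)
open Summit.AtomisticToContinuum.Crystallization.Theorems.LayeredLawsSelectHcp.Negative.DiracLaws
open Summit.AtomisticToContinuum.Crystallization.Theorems.LayeredLawsSelectHcp.Negative.IntegerForms
open Summit.AtomisticToContinuum.Crystallization.Theorems.LayeredLawsSelectHcp.Negative.FccLattice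

/-! ## §6 The fcc Palm law and its properties -/

/-- **The Palm law of the fcc lattice** at nearest-neighbour distance `a`: fcc is a Bravais
lattice, so its Palm version is the Dirac mass at `count|fccD3 a`. [folklore] -/
def fccLaw (a : ℝ) : Measure (Measure E3) :=
  Measure.dirac ((Measure.count : Measure E3).restrict (fccD3 a : Set E3))

/-- The fcc law is a probability law. [folklore] -/
instance (a : ℝ) : IsProbabilityMeasure (fccLaw a) := by
  unfold fccLaw; infer_instance

/-- The atom of the fcc law is a measurable singleton. [folklore] -/
theorem measurableSet_fccAtom (a : ℝ) :
    MeasurableSet ({(Measure.count : Measure E3).restrict (fccD3 a : Set E3)} : Set (Measure E3)) :=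
  measurableSet_singleton_count_restrict (countable_fccD3 a)

/-- H1 for the fcc law, for every `δ ≤ a`. [folklore] -/
theorem rooted_fccLaw {a δ : ℝ} (ha : 0 < a) (hδ : δ ≤ a) : Rooted δ (fccLaw a) :=
  ae_dirac_of_mem (measurableSet_fccAtom a)
    ⟨_, (fccD3 a).zero_mem, fun _ hx _ hy hne => hδ.trans (le_dist_of_mem_fccD3 ha hx hy hne), rfl⟩

/-- H2 for the fcc law. [folklore] -/
theorem pointStationary_fccLaw (a : ℝ) : PointStationary (fccLaw a) :=
  pointStationary_dirac_addSubgroup (fccD3 a) (countable_fccD3 a)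

/-- H4 for the fcc law (`9/10 ≤ a ≤ 1`). [folklore] -/
theorem layered_fccLaw {a : ℝ} (h9 : 9 / 10 ≤ a) (h1 : a ≤ 1) : Layered (fccLaw a) :=
  ae_dirac_of_mem (measurableSet_fccAtom a)
    ⟨_, rfl, fun _ hx => goodShell_fccD3 h9 h1 hx, barlowLike_fccD3 h9 h1⟩

/-- H3 for the fcc law reads `½ ∫ V_LJ(‖y‖) d(count|fccD3 a) ≤ e*`. [folklore] -/
theorem meanRootEnergy_fccLaw (a : ℝ) :
    meanRootEnergy (fccLaw a) =
      (∫ y, lennardJones ‖y‖ ∂((Measure.count : Measure E3).restrict (fccD3 a : Set E3))) / 2 :=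
  integral_dirac_of_mem (measurableSet_fccAtom a) _

/-- Equal counting measures have equal carriers. [folklore] -/
theorem set_eq_of_count_restrict_eq {S T : Set E3}
    (h : (Measure.count : Measure E3).restrict S = (Measure.count : Measure E3).restrict T) :
    S = T := by
  ext x
  have hx := congrArg (fun μ : Measure E3 => μ {x}) h
  simp only [Measure.restrict_apply (measurableSet_singleton x)] at hx
  by_cases hS : x ∈ S <;> by_cases hT : x ∈ T
  · exact ⟨fun _ => hT, fun _ => hS⟩
  · rw [Set.inter_eq_self_of_subset_left (Set.singleton_subset_iff.2 hS),
      Set.singleton_inter_eq_empty.2 hT, Measure.count_singleton, measure_empty] at hx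
    exact absurd hx one_ne_zero
  · rw [Set.inter_eq_self_of_subset_left (Set.singleton_subset_iff.2 hT),
      Set.singleton_inter_eq_empty.2 hS, Measure.count_singleton, measure_empty] at hx
    exact absurd hx.symm one_ne_zero
  · exact ⟨fun h => absurd h hS, fun h => absurd h hT⟩

/-- **The fcc configuration is not a rotated relaxed hcp crystal**: `fccD3 a` is an additive
subgroup, and no linear-isometric image of `hcpStacking a' h'` (`a', h' ≠ 0`) is one
(`HcpNotBravais_holds`). [folklore] -/
theorem not_isRelaxedHcp_fcc (a : ℝ) :
    ¬ IsRelaxedHcp ((Measure.count : Measure E3).restrict (fccD3 a : Set E3)) := by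
  rintro ⟨a', h', ha', hh', -, -, -, -, A, -, hEq⟩
  have hset : (fccD3 a : Set E3) = A '' hcpStacking a' h' := set_eq_of_count_restrict_eq hEq
  have key : (((fccD3 a).map (A.symm.toLinearEquiv : E3 →ₗ[ℝ] E3).toAddMonoidHom : AddSubgroup E3) :
      Set E3) = hcpStacking a' h' := by
    rw [AddSubgroup.coe_map]
    change (fun x => A.symm x) '' (fccD3 a : Set E3) = hcpStacking a' h'
    rw [hset, Set.image_image]
    simp
  exact Literature.Barriers.AtomisticToContinuum.HcpNotBravais_holds a' h' ha' hh' _ key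

/-- Hence the conclusion of the crux FAILS for the fcc law. [folklore] -/
theorem not_ae_isRelaxedHcp_fccLaw (a : ℝ) : ¬ ∀ᵐ μ ∂(fccLaw a), IsRelaxedHcp μ := fun h =>
  not_isRelaxedHcp_fcc a (of_ae_dirac h)

/-! ## §7 Load-bearing analysis: H3 cannot be dropped -/

/-- **Any proof of the crux must use the energy hypothesis H3**: with H3 deleted the statement is
false — the fcc Palm law (`a = 1`, `δ = 1`) is a probability law, rooted and `1`-separated,
point-stationary, every point has an EXACT cuboctahedral shell at scale `1` and the configuration
is bond-isomorphic to the ideal fcc stacking, yet fcc is not a rotated relaxed hcp. [folklore] -/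
theorem layeredLawsSelectHcp_false_without_energy :
    ¬ (∀ δ : ℝ, 0 < δ → ∀ P : Measure (Measure E3), IsProbabilityMeasure P →
        Rooted δ P → PointStationary P → Layered P → ∀ᵐ μ ∂P, IsRelaxedHcp μ) := fun H =>
  not_ae_isRelaxedHcp_fccLaw 1 (H 1 one_pos (fccLaw 1) inferInstance (rooted_fccLaw one_pos le_rfl)
    (pointStationary_fccLaw 1) (layered_fccLaw (by norm_num) le_rfl))

end Summit.AtomisticToContinuum.Crystallization.Theorems.LayeredLawsSelectHcp.Negative.FccModel

end
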